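import Summits.QuantumFields.YangMills.Theorems.SwapVirialDeficitBlowUpRingChartDefs
import Summits.QuantumFields.YangMills.Theorems.SwapVirialDeficitSwapRingCeiling
import Summits.QuantumFields.YangMills.Theorems.VirialFluxGapFixSplit
import Mathlib.Probability.ProductMeasure
import HarnessLib

/-!
# The RING CHART of the joint blow-up (brick J3 of memo-24197-massive-mode-rung), II: the reconstruction map `ringConfig χ` carries
# `Haar⁴ ⊗ Haar^{Fol}` to `μ_fix = Haar^{off} ⊗ (⊗_j configMeasure) ⊗ gaugeMeasure`
# (free-hands support of ⟨stmt-QuantumFields-24197⟩ `SwapVirialDeficit.SwapGluedStiffness`)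

The letter translations `Ψ` and the leader identification `Θ` of ✓`SwapRing.ringMeasure_real_swapDeficit_le_le_box_of_box` (there buried in one proof and
used only as an INCLUSION) are rebuilt here as ONE explicit map in the opposite direction, ✓`BlowUpRing.ringConfig` (✓`SwapVirialDeficitBlowUpRingChartDefs`),
and proved MEASURE PRESERVING:

* §0 the leader test (`isLead_iff`, `isLead_lead`, `eq_lead_of_isLead`);
* §1 `measurePreserving_curry` — currying a finite product of copies of a probability measure (Mathlib `Measure.infinitePi_map_curry`);
* §2 the three letter blocks: ★ `measurePreserving_sliceZero` (`Haar³ ⊗ Haar^{NonLead} → Haar^{off}`: skew translation by the letters, `piCongrLeft`,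
  `piEquivPiSubtypeProd`), ★ `measurePreserving_sliceMul` (`(w, b) ↦ (w, glue(w)·b)`: skew product over `w`, then currying),
  ★ `measurePreserving_seamField` (`Haar ⊗ Haar^{sites ≠ 0} → gaugeMeasure`: skew translation by `χ(x)·c`, ✓`FixSplit.measurePreserving_insertAt`);
* §3 ★★ `measurePreserving_ringConfig` — split the leaders (`piFinSuccAbove`) and the followers (`sumPiEquivProdPi`), reshuffle (`prodAssoc` ∕ `swap`), rebuild;
  `ringConfig χ` is definitionally this composition.

The sequel ✓`SwapVirialDeficitBlowUpRingChart` reads off the EXACT identities `μ_L{F^S_z ≤ s} = (Haar⁴ ⊗ Haar^{Fol}){chartDeficit ≤ s} = ∫ Haar^{Fol}{…} dHaar⁴`,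
the conjugation invariance of the inner mass and the toron box in chart coordinates.
HONEST LABEL: measure-theoretic plumbing on `SU(2)^{6L⁴+1}` for a plan-level fixed-`L` rung of a DRAFT line; NOT ⟨24197⟩, NOT the massive-mode rung;
the Yang–Mills mass gap is NOT proved; no summit is proved by a line.  THEOREMS ONLY (0 `def`, 0 `sorry`), standard axioms.  Width seat
ym-line-sfw-p2-w2 g57 (cell ym-idea-1, free hands), `--supports stmt-QuantumFields-24197`.  References: [cite: SeilerLNP1982, §2]; [cite: Luscher1983, §2];
[cite: tHooft1979]; [folklore].
-/

set_option autoImplicit false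

noncomputable section

open MeasureTheory
open scoped BigOperators ENNReal
open Literature.MathematicalPhysics.QuantumFieldTheory hiding SU2
open Literature.MathematicalPhysics.QuantumLattice

namespace Summit.QuantumFields.YangMills.Theorems.SwapVirialDeficit.BlowUpRing

open Summit.QuantumFields.YangMills.Theorems.FemtoTransferGap
open Summit.QuantumFields.YangMills.Theorems.FemtoTransferGap.TT
open Summit.QuantumFields.YangMills.Theorems.VirialFluxGap.RingDeficit
open Summit.QuantumFields.YangMills.Theorems.VirialFluxGap.FixSplit (FixSpace card_offIdx measurePreserving_insertAt)
open Summit.QuantumFields.YangMills.Theorems.SwapTwistDeficit.PeriodicRingFloor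
open Summit.QuantumFields.YangMills.Theorems.SwapVirialDeficit.SwapRing

variable {L : ℕ} [NeZero L]

/-! ## §0 The leader test -/

omit [NeZero L] in
/-- `isLead i` unfolded. [folklore] -/
theorem isLead_iff (i : OffIdx L) : isLead i = true ↔ i.1.1 = Pi.single i.1.2 (-1 : ZMod L) := by
  unfold isLead; exact decide_eq_true_iff

omit [NeZero L] in
/-- The wrap link `(−ê_μ, μ)` is the leader of direction `μ`. [folklore] -/
theorem isLead_lead (μ : Fin 3) : isLead (⟨(Pi.single μ (-1 : ZMod L), μ), leader_not_treeEdge μ⟩ : OffIdx L) = true :=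
  (isLead_iff _).2 rfl

omit [NeZero L] in
/-- A leader is the wrap link of its own direction. [folklore] -/
theorem eq_lead_of_isLead {i : OffIdx L} (h : isLead i = true) :
    i = ⟨(Pi.single i.1.2 (-1 : ZMod L), i.1.2), leader_not_treeEdge i.1.2⟩ :=
  Subtype.ext (Prod.ext ((isLead_iff i).1 h) rfl)

omit [NeZero L] in
/-- A leader link crosses the plane of its own direction: its letter is itself. [folklore] -/
theorem apply_eq_neg_one_of_isLead {i : OffIdx L} (h : isLead i = true) : i.1.1 i.1.2 = -1 := by
  rw [(isLead_iff i).1 h]; simp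

/-! ## §1 Currying a finite product of copies of a probability measure -/

section Curry

variable {J E X : Type*} [Fintype J] [Fintype E] [MeasurableSpace X]

/-- **Currying preserves product probability measures**: `(J × E → X, ⊗μ) → (J → (E → X), ⊗(⊗μ))` (Mathlib `Measure.infinitePi_map_curry` on finite
index types). [folklore] -/
theorem measurePreserving_curry (μ : Measure X) [IsProbabilityMeasure μ] :
    MeasurePreserving (MeasurableEquiv.curry J E X) (Measure.pi fun _ : J × E => μ)
      (Measure.pi fun _ : J => Measure.pi fun _ : E => μ) := by
  refine ⟨(MeasurableEquiv.curry J E X).measurable, ?_⟩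
  have h := Measure.infinitePi_map_curry (fun (_ : J) (_ : E) => μ)
  simp only [Measure.infinitePi_eq_pi] at h
  exact h

end Curry

/-! ## §2 The three letter blocks: slice `0`, the slices `1 … 2L−1`, the seam -/

/-- ★ **Slice `0` rebuilt preserves measure**: `(C', V) ↦ sliceZero C' V` carries `Haar³ ⊗ Haar^{NonLead}` to `Haar^{off}` (letter translations are a skew
product; the leaders are re-indexed by `{i // isLead i} ≃ Fin 3`; the two blocks are glued by `piEquivPiSubtypeProd`). [folklore] -/
theorem measurePreserving_sliceZero :
    MeasurePreserving (fun p : (Fin 3 → SU2) × (NonLead L → SU2) => sliceZero p.1 p.2)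
      ((Measure.pi fun _ : Fin 3 => haarProbability SU2).prod (Measure.pi fun _ : NonLead L => haarProbability SU2))
      (Measure.pi fun _ : OffIdx L => haarProbability SU2) := by
  haveI : (haarProbability SU2).IsMulLeftInvariant := by unfold haarProbability; infer_instance
  set η : Measure SU2 := haarProbability SU2 with hη
  set π3 : Measure (Fin 3 → SU2) := Measure.pi fun _ => η with hπ3
  set πA : Measure (NonLead L → SU2) := Measure.pi fun _ => η with hπA
  set πL : Measure ({i : OffIdx L // isLead i = true} → SU2) := Measure.pi fun _ => η with hπL
  -- the leader coordinates `{i // isLead i} ≃ Fin 3`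
  set eL : {i : OffIdx L // isLead i = true} ≃ Fin 3 :=
    { toFun := fun i => i.1.1.2
      invFun := fun μ => ⟨⟨(Pi.single μ (-1 : ZMod L), μ), leader_not_treeEdge μ⟩, isLead_lead μ⟩
      left_inv := fun i => Subtype.ext (eq_lead_of_isLead i.2).symm
      right_inv := fun μ => rfl } with heL
  -- (1) the skew translation of the non-leaders by their letters
  set sk : (Fin 3 → SU2) × (NonLead L → SU2) → (Fin 3 → SU2) × (NonLead L → SU2) :=
    fun p => (id p.1, fun i => letter p.1 i.1 * p.2 i) with hsk
  have hletter : ∀ i : OffIdx L, Measurable fun C : Fin 3 → SU2 => letter C i := by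
    intro i
    by_cases hx : i.1.1 i.1.2 = -1
    · simp only [letter, hx, if_true]; exact measurable_pi_apply _
    · simp only [letter, hx, if_false]; exact measurable_const
  have hskm : Measurable (Function.uncurry fun (C : Fin 3 → SU2) (V : NonLead L → SU2) (i : NonLead L) => letter C i.1 * V i) :=
    measurable_pi_lambda _ fun i => ((hletter i.1).comp measurable_fst).mul ((measurable_pi_apply i).comp measurable_snd)
  have hsk_mp : MeasurePreserving sk (π3.prod πA) (π3.prod πA) :=
    (MeasurePreserving.id π3).skew_product hskm (ae_of_all _ fun C =>
      (measurePreserving_pi (fun _ : NonLead L => η) (fun _ : NonLead L => η)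
        (fun i => measurePreserving_mul_left η (letter C i.1))).map_eq)
  -- (2) re-index the leaders, (3) glue the two blocks
  set pL := (MeasurableEquiv.piCongrLeft (fun _ : Fin 3 => SU2) eL).symm with hpL
  have hpL_mp : MeasurePreserving pL π3 πL := (measurePreserving_piCongrLeft (fun _ : Fin 3 => η) eL).symm _
  set pS := (MeasurableEquiv.piEquivPiSubtypeProd (fun _ : OffIdx L => SU2) (fun i => isLead i = true)).symm with hpS
  have hpS_mp : MeasurePreserving pS (πL.prod πA) (Measure.pi fun _ : OffIdx L => η) :=
    (measurePreserving_piEquivPiSubtypeProd (fun _ : OffIdx L => η) (fun i => isLead i = true)).symm _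
  have hcomp : MeasurePreserving (fun p => pS (Prod.map pL id (sk p))) (π3.prod πA) (Measure.pi fun _ : OffIdx L => η) :=
    hpS_mp.comp ((hpL_mp.prod (MeasurePreserving.id πA)).comp hsk_mp)
  have hfun : (fun p : (Fin 3 → SU2) × (NonLead L → SU2) => sliceZero p.1 p.2) = fun p => pS (Prod.map pL id (sk p)) := by
    funext p; funext i
    by_cases h : isLead i = true
    · simp only [sliceZero, h, dif_pos, hpS, MeasurableEquiv.piEquivPiSubtypeProd, MeasurableEquiv.symm_mk, MeasurableEquiv.coe_mk,
        Equiv.piEquivPiSubtypeProd_symm_apply, Prod.map_fst]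
      rfl
    · simp only [sliceZero, h, hpS, MeasurableEquiv.piEquivPiSubtypeProd, MeasurableEquiv.symm_mk,
        MeasurableEquiv.coe_mk, Equiv.piEquivPiSubtypeProd_symm_apply, Prod.map_snd]
      rfl
  rw [hfun]
  exact hcomp

/-- ★ **The slices rebuilt preserve measure**: `(w, b) ↦ (w, (j, e) ↦ glue(w) e · b (j, e))` carries `Haar^{off} ⊗ Haar^{(2L−1) × edges}` to
`Haar^{off} ⊗ (⊗_{j} configMeasure)` (a skew product over `w` of letter translations, then currying). [folklore] -/
theorem measurePreserving_sliceMul :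
    MeasurePreserving (fun p : (OffIdx L → SU2) × (Fin (2 * L - 1) × Edge 3 L → SU2) =>
        (p.1, fun (j : Fin (2 * L - 1)) (e : Edge 3 L) => glue p.1 e * p.2 (j, e)))
      ((Measure.pi fun _ : OffIdx L => haarProbability SU2).prod (Measure.pi fun _ : Fin (2 * L - 1) × Edge 3 L => haarProbability SU2))
      ((Measure.pi fun _ : OffIdx L => haarProbability SU2).prod (Measure.pi fun _ : Fin (2 * L - 1) => configMeasure SU2 L)) := by
  haveI : (haarProbability SU2).IsMulLeftInvariant := by unfold haarProbability; infer_instance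
  set η : Measure SU2 := haarProbability SU2 with hη
  set πB : Measure (Fin (2 * L - 1) × Edge 3 L → SU2) := Measure.pi fun _ => η with hπB
  -- the fibre over `w`: translate by the glued letters, then curry
  have hT : ∀ w : OffIdx L → SU2, MeasurePreserving (fun b : Fin (2 * L - 1) × Edge 3 L → SU2 =>
      fun (j : Fin (2 * L - 1)) (e : Edge 3 L) => glue w e * b (j, e)) πB (Measure.pi fun _ : Fin (2 * L - 1) => configMeasure SU2 L) := by
    intro w
    have h1 : MeasurePreserving (fun (b : Fin (2 * L - 1) × Edge 3 L → SU2) (p : Fin (2 * L - 1) × Edge 3 L) => glue w p.2 * b p) πB πB :=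
      measurePreserving_pi (fun _ => η) (fun _ => η) fun p => measurePreserving_mul_left η (glue w p.2)
    have h2 : MeasurePreserving (MeasurableEquiv.curry (Fin (2 * L - 1)) (Edge 3 L) SU2) πB
        (Measure.pi fun _ : Fin (2 * L - 1) => configMeasure SU2 L) := by
      unfold configMeasure; exact measurePreserving_curry η
    exact h2.comp h1
  have hm : Measurable (Function.uncurry fun (w : OffIdx L → SU2) (b : Fin (2 * L - 1) × Edge 3 L → SU2) =>
      fun (j : Fin (2 * L - 1)) (e : Edge 3 L) => glue w e * b (j, e)) := by
    refine measurable_pi_lambda _ fun j => measurable_pi_lambda _ fun e => ?_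
    exact ((measurable_pi_apply e).comp (measurable_glue.comp measurable_fst)).mul ((measurable_pi_apply (j, e)).comp measurable_snd)
  exact (MeasurePreserving.id _).skew_product hm (ae_of_all _ fun w => (hT w).map_eq)

/-- ★ **The seam rebuilt preserves measure**: `(c, V) ↦ seamField χ c V` carries `Haar ⊗ Haar^{sites ≠ 0}` to `gaugeMeasure L` (a skew translation by
`χ(x)·c`, then re-insertion of the coordinate `0`, ✓`FixSplit.measurePreserving_insertAt`). [folklore] -/
theorem measurePreserving_seamField (χ : Site 3 L → SU2) :
    MeasurePreserving (fun p : SU2 × (SeamRest L → SU2) => seamField χ p.1 p.2)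
      ((haarProbability SU2).prod (Measure.pi fun _ : SeamRest L => haarProbability SU2)) (gaugeMeasure L) := by
  haveI : (haarProbability SU2).IsMulLeftInvariant := by unfold haarProbability; infer_instance
  set η : Measure SU2 := haarProbability SU2 with hη
  set πC : Measure (SeamRest L → SU2) := Measure.pi fun _ => η with hπC
  set sk : SU2 × (SeamRest L → SU2) → SU2 × (SeamRest L → SU2) := fun p => (id p.1, fun x => χ x.1 * p.1 * p.2 x) with hsk
  have hskm : Measurable (Function.uncurry fun (c : SU2) (V : SeamRest L → SU2) (x : SeamRest L) => χ x.1 * c * V x) :=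
    measurable_pi_lambda _ fun x => ((measurable_const.mul measurable_fst)).mul ((measurable_pi_apply x).comp measurable_snd)
  have hsk_mp : MeasurePreserving sk (η.prod πC) (η.prod πC) :=
    (MeasurePreserving.id η).skew_product hskm (ae_of_all _ fun c =>
      (measurePreserving_pi (fun _ : SeamRest L => η) (fun _ : SeamRest L => η) (fun x => measurePreserving_mul_left η (χ x.1 * c))).map_eq)
  have hins := measurePreserving_insertAt (κ := Site 3 L) η (0 : Site 3 L)
  have hcomp := hins.comp hsk_mp
  have hfun : (fun p : SU2 × (SeamRest L → SU2) => seamField χ p.1 p.2) =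
      (fun p : SU2 × ({i : Site 3 L // ¬ i = 0} → SU2) => fun i : Site 3 L => if h : i = 0 then p.1 else p.2 ⟨i, h⟩) ∘ sk := by
    funext p; funext x
    by_cases h : x = 0
    · simp only [seamField, h, dif_pos, Function.comp_apply, hsk, id]
    · simp only [seamField, h, dif_neg, not_false_eq_true, Function.comp_apply, hsk, id]
  rw [hfun]
  unfold gaugeMeasure
  exact hcomp

/-! ## §3 The reconstruction map preserves measure -/

/-- ★★ **`ringConfig χ` CARRIES `Haar⁴ ⊗ Haar^{Fol}` TO `μ_fix = Haar^{off} ⊗ (⊗_j configMeasure) ⊗ gaugeMeasure`.**  Split the leaders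
`C ↦ (C 3, C ∘ castSucc)` (`piFinSuccAbove`) and the followers into their three blocks (`sumPiEquivProdPi`), reshuffle, rebuild slice `0`
(`measurePreserving_sliceZero`) and the seam (`measurePreserving_seamField`), then the slices by the skew product `measurePreserving_sliceMul`;
`ringConfig χ` is literally this composition. [folklore] -/
theorem measurePreserving_ringConfig (χ : Site 3 L → SU2) :
    MeasurePreserving (ringConfig χ)
      ((Measure.pi fun _ : Fin 4 => haarProbability SU2).prod (Measure.pi fun _ : Fol L => haarProbability SU2))
      ((Measure.pi fun _ : OffIdx L => haarProbability SU2).prod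
        ((Measure.pi fun _ : Fin (2 * L - 1) => configMeasure SU2 L).prod (gaugeMeasure L))) := by
  haveI : IsProbabilityMeasure (gaugeMeasure L) := isProbabilityMeasure_gaugeMeasure (L := L)
  set η : Measure SU2 := haarProbability SU2 with hη
  set π4 : Measure (Fin 4 → SU2) := Measure.pi fun _ => η with hπ4
  set π3 : Measure (Fin 3 → SU2) := Measure.pi fun _ => η with hπ3
  set πF : Measure (Fol L → SU2) := Measure.pi fun _ => η with hπF
  set πA : Measure (NonLead L → SU2) := Measure.pi fun _ => η with hπA
  set πBC : Measure ((Fin (2 * L - 1) × Edge 3 L) ⊕ SeamRest L → SU2) := Measure.pi fun _ => η with hπBC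
  set πB : Measure (Fin (2 * L - 1) × Edge 3 L → SU2) := Measure.pi fun _ => η with hπB
  set πC : Measure (SeamRest L → SU2) := Measure.pi fun _ => η with hπC
  set μA : Measure (OffIdx L → SU2) := Measure.pi fun _ => η with hμA
  set μB : Measure (Fin (2 * L - 1) → GaugeConfig 3 L SU2) := Measure.pi fun _ => configMeasure SU2 L with hμB
  set μC : Measure (Site 3 L → SU2) := gaugeMeasure L with hμC
  /- S1: split the leaders `C ↦ (C 3, C ∘ castSucc)` and the followers into the three blocks -/
  have h4 : MeasurePreserving (fun C : Fin 4 → SU2 => (C (Fin.last 3), fun μ : Fin 3 => C (Fin.castSucc μ))) π4 (η.prod π3) := by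
    have h := measurePreserving_piFinSuccAbove (fun _ : Fin 4 => η) (Fin.last 3)
    have hf : (fun C : Fin 4 → SU2 => (C (Fin.last 3), fun μ : Fin 3 => C (Fin.castSucc μ))) =
        ⇑(MeasurableEquiv.piFinSuccAbove (fun _ : Fin 4 => SU2) (Fin.last 3)) := by
      funext C
      refine Prod.ext rfl (funext fun μ => ?_)
      show C (Fin.castSucc μ) = C ((Fin.last 3).succAbove μ)
      rw [Fin.succAbove_last]
    rw [hf]
    exact h
  have hF1 : MeasurePreserving (MeasurableEquiv.sumPiEquivProdPi fun _ : NonLead L ⊕ ((Fin (2 * L - 1) × Edge 3 L) ⊕ SeamRest L) => SU2) πF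
      (πA.prod πBC) := measurePreserving_sumPiEquivProdPi fun _ => η
  have hF2 : MeasurePreserving (MeasurableEquiv.sumPiEquivProdPi fun _ : (Fin (2 * L - 1) × Edge 3 L) ⊕ SeamRest L => SU2) πBC (πB.prod πC) :=
    measurePreserving_sumPiEquivProdPi fun _ => η
  have hS1 : MeasurePreserving (fun q : (Fin 4 → SU2) × (Fol L → SU2) =>
      ((q.1 (Fin.last 3), fun μ : Fin 3 => q.1 (Fin.castSucc μ)),
        ((fun i : NonLead L => q.2 (Sum.inl i)),
          ((fun b : Fin (2 * L - 1) × Edge 3 L => q.2 (Sum.inr (Sum.inl b))), (fun x : SeamRest L => q.2 (Sum.inr (Sum.inr x)))))))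
      (π4.prod πF) ((η.prod π3).prod (πA.prod (πB.prod πC))) :=
    h4.prod (((MeasurePreserving.id πA).prod hF2).comp hF1)
  /- S2: the reshuffle `((c, C'), (a, (b, d))) ↦ ((C', a), (b, (c, d)))` -/
  have q1 : MeasurePreserving (fun p : SU2 × ((Fin (2 * L - 1) × Edge 3 L → SU2) × (SeamRest L → SU2)) => (p.2.1, (p.1, p.2.2)))
      (η.prod (πB.prod πC)) (πB.prod (η.prod πC)) :=
    (measurePreserving_prodAssoc πB η πC).comp
      (((Measure.measurePreserving_swap (μ := η) (ν := πB)).prod (MeasurePreserving.id πC)).comp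
        (measurePreserving_prodAssoc η πB πC).symm)
  have q2 : MeasurePreserving (fun p : (SU2 × (Fin 3 → SU2)) × ((NonLead L → SU2) × ((Fin (2 * L - 1) × Edge 3 L → SU2) × (SeamRest L → SU2))) =>
      ((p.1.2, p.2.1), (p.1.1, p.2.2)))
      ((η.prod π3).prod (πA.prod (πB.prod πC))) ((π3.prod πA).prod (η.prod (πB.prod πC))) := by
    -- `((c, C'), (a, m)) ↦ (c, (C', (a, m))) ↦ (c, ((C', a), m)) ↦ ((c, (C', a)), m) ↦ (((C', a), c), m) ↦ ((C', a), (c, m))`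
    exact (measurePreserving_prodAssoc (π3.prod πA) η (πB.prod πC)).comp
      ((((Measure.measurePreserving_swap (μ := η) (ν := π3.prod πA))).prod (MeasurePreserving.id (πB.prod πC))).comp
        ((measurePreserving_prodAssoc η (π3.prod πA) (πB.prod πC)).symm.comp
          (((MeasurePreserving.id η).prod (measurePreserving_prodAssoc π3 πA (πB.prod πC)).symm).comp
            (measurePreserving_prodAssoc η π3 (πA.prod (πB.prod πC))))))
  have hS2 : MeasurePreserving (fun p : (SU2 × (Fin 3 → SU2)) × ((NonLead L → SU2) × ((Fin (2 * L - 1) × Edge 3 L → SU2) × (SeamRest L → SU2))) =>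
      ((p.1.2, p.2.1), (p.2.2.1, (p.1.1, p.2.2.2))))
      ((η.prod π3).prod (πA.prod (πB.prod πC))) ((π3.prod πA).prod (πB.prod (η.prod πC))) :=
    ((MeasurePreserving.id (π3.prod πA)).prod q1).comp q2
  /- S3: rebuild slice 0 and the seam; S4: rebuild the slices -/
  have hS3 : MeasurePreserving (fun p : ((Fin 3 → SU2) × (NonLead L → SU2)) × ((Fin (2 * L - 1) × Edge 3 L → SU2) × (SU2 × (SeamRest L → SU2))) =>
      (sliceZero p.1.1 p.1.2, (p.2.1, seamField χ p.2.2.1 p.2.2.2)))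
      ((π3.prod πA).prod (πB.prod (η.prod πC))) (μA.prod (πB.prod μC)) :=
    (measurePreserving_sliceZero (L := L)).prod ((MeasurePreserving.id πB).prod (measurePreserving_seamField (L := L) χ))
  have hS4 : MeasurePreserving (fun p : (OffIdx L → SU2) × ((Fin (2 * L - 1) × Edge 3 L → SU2) × (Site 3 L → SU2)) =>
      (p.1, ((fun (j : Fin (2 * L - 1)) (e : Edge 3 L) => glue p.1 e * p.2.1 (j, e)), p.2.2)))
      (μA.prod (πB.prod μC)) (μA.prod (μB.prod μC)) := by
    have hm : Measurable (Function.uncurry fun (w : OffIdx L → SU2) (m : (Fin (2 * L - 1) × Edge 3 L → SU2) × (Site 3 L → SU2)) =>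
        ((fun (j : Fin (2 * L - 1)) (e : Edge 3 L) => glue w e * m.1 (j, e)), m.2)) := by
      refine Measurable.prodMk ?_ (measurable_snd.comp measurable_snd)
      refine measurable_pi_lambda _ fun j => measurable_pi_lambda _ fun e => ?_
      exact ((measurable_pi_apply e).comp (measurable_glue.comp measurable_fst)).mul
        ((measurable_pi_apply (j, e)).comp (measurable_fst.comp measurable_snd))
    have hfib : ∀ w : OffIdx L → SU2, MeasurePreserving (fun m : (Fin (2 * L - 1) × Edge 3 L → SU2) × (Site 3 L → SU2) =>
        ((fun (j : Fin (2 * L - 1)) (e : Edge 3 L) => glue w e * m.1 (j, e)), m.2)) (πB.prod μC) (μB.prod μC) := by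
      intro w
      have hT : MeasurePreserving (fun b : Fin (2 * L - 1) × Edge 3 L → SU2 => fun (j : Fin (2 * L - 1)) (e : Edge 3 L) => glue w e * b (j, e))
          πB μB := by
        haveI : (haarProbability SU2).IsMulLeftInvariant := by unfold haarProbability; infer_instance
        have h1 : MeasurePreserving (fun (b : Fin (2 * L - 1) × Edge 3 L → SU2) (p : Fin (2 * L - 1) × Edge 3 L) => glue w p.2 * b p) πB πB :=
          measurePreserving_pi (fun _ => η) (fun _ => η) fun p => measurePreserving_mul_left η (glue w p.2)
        have h2 : MeasurePreserving (MeasurableEquiv.curry (Fin (2 * L - 1)) (Edge 3 L) SU2) πB μB := by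
          rw [hμB]; unfold configMeasure; exact measurePreserving_curry η
        exact h2.comp h1
      exact hT.prod (MeasurePreserving.id μC)
    exact (MeasurePreserving.id μA).skew_product hm (ae_of_all _ fun w => (hfib w).map_eq)
  have hcomp := hS4.comp (hS3.comp (hS2.comp hS1))
  exact hcomp

end Summit.QuantumFields.YangMills.Theorems.SwapVirialDeficit.BlowUpRing

end
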